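import Summits.ABC.ABC.Theses.IsogenyGlueCongruence
import Summits.ABC.ABC.Theorems.IsogenyGlueCongruenceSharpDegreeOfPolyDegreeValuation

set_option linter.dupNamespace false

/-!
# Crux `SharpDegreeOfPolyHeight` (stmt-ABC-16009): exponent collapse at large primes under `H`

`R' := SharpDegreeOfPolyHeight = (H → X)`, `H` = the polynomial height (undetermined-exponent Szpiro)
conjecture for semistable curves — the antecedent of the route decl, inlined below VERBATIM as a
hypothesis — and `X = SemistableDegreeConjecture`.  This support file (`--supports stmt-ABC-16009`)
moves into the theorem tree the one consequence of `H` that the crux-ideation census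
(`Cruxes/SharpDegreeOfPolyHeight/BarrierNotes-r1-k2.md` §2 D-b, workfile `Ideator2Sketch.lean`, by
planner-cruxidea-stmt-ABC-16009-2-0) found to act WITHOUT exponent loss, so that any future line on this
crux (the sibling card `totient-level-ledger` transposed to height form) can import it:

* `polySzpiro_of_polyHeight` — `H` ⟹ polynomial Szpiro `|Δ_min(E)| ≤ A' · N_E^m` for EVERY semistable
  elliptic `E/ℚ` (through a global minimal model; in height form no Zagier / Petersson / Manin input is
  needed, the one place `R'` is cleaner than `R = SharpDegreeOfPolyDegree`);
* `valuationLogBound_of_polySzpiro`, `valuationLogBound_of_polyHeight` — `v_p(Δ_min(E)) · log p ≤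
  A log N_E + A` with `A ≥ 0`;
* `largePrimeExponentBound_of_polyHeight` — **exponent collapse**: for every `θ > 0` there is
  `B = B(θ, H)` with `v_p(Δ_min(E)) ≤ B` at every prime `p ∣ N_E` with `p ≥ N_E^θ`.

Theorems only (no definition, no named fact); `H` is a hypothesis everywhere and `R'` itself is not
touched: the crux stays `blocked-on stmt-ABC-2044` (it closes by
`sharpDegreeOfPolyHeight_of_semistableDegreeConjecture` the day `X` lands).  Proofs adapted from the
ideator's workfile `Cruxes/SharpDegreeOfPolyHeight/Ideator2Sketch.lean` (kernel-checked there, rc 0).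
-/

noncomputable section

namespace Summit.ABC.ABC.Theorems.SharpDegreeOfPolyHeight

open Summit.ABC.ABC.Theses.IsogenyGlueCongruence
open Literature.NumberTheory.EllipticCurves Literature.NumberTheory.EllipticCurves.ModularForms
open Literature.NumberTheory.DiophantineGeometry
open WeierstrassCurve

/-- **`H` ⟹ polynomial Szpiro** for every semistable `E/ℚ`: if `max(|Δ_W|, |c₄(W)|³) ≤ C · N_W^σ` on
semistable global minimal models, then there are `m ≥ 0`, `A'` with `|Δ_min(E)| ≤ A' · N_E^m` for every
semistable elliptic `E/ℚ` (pass to a global minimal model, `…Negative.exists_globallyMinimal_model`).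
[folklore] -/
theorem polySzpiro_of_polyHeight
    (hH : ∃ σ C : ℝ, ∀ (W : WeierstrassCurve ℚ) [W.IsElliptic] [W.IsGloballyMinimal]
      [NeZero (W.conductorNorm ℤ)], W.IsSemistable ℤ →
        ((max |W.Δ| (|W.c₄| ^ 3) : ℚ) : ℝ) ≤ C * (W.conductorNorm ℤ : ℝ) ^ σ) :
    ∃ m A' : ℝ, 0 ≤ m ∧ ∀ (W : WeierstrassCurve ℚ) [W.IsElliptic], W.IsSemistable ℤ →
      (W.minimalDiscriminantNorm ℤ : ℝ) ≤ A' * (W.conductorNorm ℤ : ℝ) ^ m := by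
  obtain ⟨K, C, h⟩ := hH
  refine ⟨max K 0, max C 0, le_max_right _ _, fun W _ hss => ?_⟩
  obtain ⟨W₁, hE₁, hM₁, hss₁, hN₁, hΔ₁⟩ :=
    Summit.ABC.ABC.Theorems.SharpDegreeOfPolyDegree.Negative.exists_globallyMinimal_model W
  haveI := hE₁
  haveI := hM₁
  have hNpos : 0 < W₁.conductorNorm ℤ := conductorNorm_pos_holds W₁
  haveI : NeZero (W₁.conductorNorm ℤ) := ⟨hNpos.ne'⟩
  have h1 := h W₁ (hss₁ hss)
  have hN1 : (1 : ℝ) ≤ (W₁.conductorNorm ℤ : ℝ) := by exact_mod_cast hNpos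
  have hN0 : (0 : ℝ) ≤ (W₁.conductorNorm ℤ : ℝ) := by linarith
  calc (W.minimalDiscriminantNorm ℤ : ℝ) = ((|W₁.Δ| : ℚ) : ℝ) := hΔ₁.symm
    _ ≤ ((max |W₁.Δ| (|W₁.c₄| ^ 3) : ℚ) : ℝ) := Rat.cast_le.mpr (le_max_left _ _)
    _ ≤ C * (W₁.conductorNorm ℤ : ℝ) ^ K := h1
    _ ≤ max C 0 * (W₁.conductorNorm ℤ : ℝ) ^ K :=
        mul_le_mul_of_nonneg_right (le_max_left _ _) (Real.rpow_nonneg hN0 _)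
    _ ≤ max C 0 * (W₁.conductorNorm ℤ : ℝ) ^ (max K 0) :=
        mul_le_mul_of_nonneg_left (Real.rpow_le_rpow_of_exponent_le hN1 (le_max_left _ _))
          (le_max_right _ _)
    _ = max C 0 * (W.conductorNorm ℤ : ℝ) ^ (max K 0) := by rw [hN₁]

/-- **Single-valuation bound under polynomial Szpiro**: if `|Δ_min(E)| ≤ A' · N_E^m` (`m ≥ 0`) for
every semistable `E/ℚ`, then there is `A ≥ 0` with `v_p(Δ_min(E)) · log p ≤ A · log N_E + A` for every
semistable `E/ℚ` and every prime `p` (`v_p log p ≤ log |Δ_min| ≤ log A' + m log N`). [folklore] -/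
theorem valuationLogBound_of_polySzpiro
    (hSz : ∃ m A' : ℝ, 0 ≤ m ∧ ∀ (W : WeierstrassCurve ℚ) [W.IsElliptic], W.IsSemistable ℤ →
      (W.minimalDiscriminantNorm ℤ : ℝ) ≤ A' * (W.conductorNorm ℤ : ℝ) ^ m) :
    ∃ A : ℝ, 0 ≤ A ∧ ∀ (W : WeierstrassCurve ℚ) [W.IsElliptic], W.IsSemistable ℤ → ∀ p : ℕ, p.Prime →
      (((W.minimalDiscriminantNorm ℤ).factorization p : ℕ) : ℝ) * Real.log p ≤
        A * Real.log (W.conductorNorm ℤ) + A := by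
  obtain ⟨m, A', hm, h⟩ := hSz
  refine ⟨max (Real.log (max A' 1)) m, le_trans hm (le_max_right _ _), fun W _ hss p hp => ?_⟩
  have hΔpos : 0 < W.minimalDiscriminantNorm ℤ := minimalDiscriminantNorm_pos_holds W
  have hNpos : 0 < W.conductorNorm ℤ := conductorNorm_pos_holds W
  have hN1 : (1 : ℝ) ≤ (W.conductorNorm ℤ : ℝ) := by exact_mod_cast hNpos
  have hlogN : 0 ≤ Real.log (W.conductorNorm ℤ : ℝ) := Real.log_nonneg hN1
  have h1 := Summit.ABC.ABC.Theorems.SharpDegreeOfPolyDegree.factorization_mul_log_le hΔpos.ne' hp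
    (n := W.minimalDiscriminantNorm ℤ)
  have hA1 : 1 ≤ max A' 1 := le_max_right _ _
  have h2 : (W.minimalDiscriminantNorm ℤ : ℝ) ≤ max A' 1 * (W.conductorNorm ℤ : ℝ) ^ m :=
    (h W hss).trans (mul_le_mul_of_nonneg_right (le_max_left _ _) (Real.rpow_nonneg (by linarith) _))
  have hΔr : (0 : ℝ) < (W.minimalDiscriminantNorm ℤ : ℝ) := by exact_mod_cast hΔpos
  have h3 : Real.log (W.minimalDiscriminantNorm ℤ : ℝ) ≤
      Real.log (max A' 1) + m * Real.log (W.conductorNorm ℤ : ℝ) := by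
    calc Real.log (W.minimalDiscriminantNorm ℤ : ℝ)
          ≤ Real.log (max A' 1 * (W.conductorNorm ℤ : ℝ) ^ m) := Real.log_le_log hΔr h2
      _ = Real.log (max A' 1) + m * Real.log (W.conductorNorm ℤ : ℝ) := by
          rw [Real.log_mul (ne_of_gt (lt_of_lt_of_le one_pos hA1))
            (ne_of_gt (Real.rpow_pos_of_pos (by linarith) _)), Real.log_rpow (by linarith)]
  calc (((W.minimalDiscriminantNorm ℤ).factorization p : ℕ) : ℝ) * Real.log p
        ≤ Real.log (max A' 1) + m * Real.log (W.conductorNorm ℤ : ℝ) := h1.trans h3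
    _ ≤ max (Real.log (max A' 1)) m +
          max (Real.log (max A' 1)) m * Real.log (W.conductorNorm ℤ : ℝ) :=
        add_le_add (le_max_left _ _) (mul_le_mul_of_nonneg_right (le_max_right _ _) hlogN)
    _ = max (Real.log (max A' 1)) m * Real.log (W.conductorNorm ℤ) +
          max (Real.log (max A' 1)) m := by
        ring

/-- **`H` ⟹ single-valuation bound**: under the polynomial height hypothesis there is `A ≥ 0` with
`v_p(Δ_min(E)) · log p ≤ A · log N_E + A` for every semistable elliptic `E/ℚ` and every prime `p`.
[folklore] -/
theorem valuationLogBound_of_polyHeight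
    (hH : ∃ σ C : ℝ, ∀ (W : WeierstrassCurve ℚ) [W.IsElliptic] [W.IsGloballyMinimal]
      [NeZero (W.conductorNorm ℤ)], W.IsSemistable ℤ →
        ((max |W.Δ| (|W.c₄| ^ 3) : ℚ) : ℝ) ≤ C * (W.conductorNorm ℤ : ℝ) ^ σ) :
    ∃ A : ℝ, 0 ≤ A ∧ ∀ (W : WeierstrassCurve ℚ) [W.IsElliptic], W.IsSemistable ℤ → ∀ p : ℕ, p.Prime →
      (((W.minimalDiscriminantNorm ℤ).factorization p : ℕ) : ℝ) * Real.log p ≤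
        A * Real.log (W.conductorNorm ℤ) + A :=
  valuationLogBound_of_polySzpiro (polySzpiro_of_polyHeight hH)

/-- **Exponent collapse at large primes under `H`**: for every `θ > 0` there is `B = B(θ, H)` such
that every semistable elliptic `E/ℚ` has `v_p(Δ_min(E)) ≤ B` at every prime `p ∣ N_E` with
`p ≥ N_E^θ` (from `v_p · θ log N ≤ v_p log p ≤ A log N + A` and `log N ≥ log 2`; explicitly
`B = A/θ + A/(θ log 2)`).  On the primes `≥ N^θ` Szpiro's weighted sum `Σ v_p log p` thus has BOUNDED
coefficients; the discriminant mass on primes `< N^θ` is untouched by `H`. [folklore] -/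
theorem largePrimeExponentBound_of_polyHeight
    (hH : ∃ σ C : ℝ, ∀ (W : WeierstrassCurve ℚ) [W.IsElliptic] [W.IsGloballyMinimal]
      [NeZero (W.conductorNorm ℤ)], W.IsSemistable ℤ →
        ((max |W.Δ| (|W.c₄| ^ 3) : ℚ) : ℝ) ≤ C * (W.conductorNorm ℤ : ℝ) ^ σ)
    {θ : ℝ} (hθ : 0 < θ) :
    ∃ B : ℝ, ∀ (W : WeierstrassCurve ℚ) [W.IsElliptic], W.IsSemistable ℤ → ∀ p : ℕ, p.Prime →
      p ∣ W.conductorNorm ℤ → (W.conductorNorm ℤ : ℝ) ^ θ ≤ p →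
        (((W.minimalDiscriminantNorm ℤ).factorization p : ℕ) : ℝ) ≤ B := by
  obtain ⟨A, hA0, hA⟩ := valuationLogBound_of_polyHeight hH
  have hlog2 : 0 < Real.log 2 := Real.log_pos (by norm_num)
  refine ⟨A / θ + A / (θ * Real.log 2), fun W _ hss p hp hpN hNθ => ?_⟩
  have hNpos : 0 < W.conductorNorm ℤ := conductorNorm_pos_holds W
  -- `p ∣ N` and `p ≥ 2` give `N ≥ 2`, so `log N ≥ log 2 > 0`.
  have hN2 : (2 : ℝ) ≤ (W.conductorNorm ℤ : ℝ) := by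
    have : p ≤ W.conductorNorm ℤ := Nat.le_of_dvd hNpos hpN
    exact_mod_cast hp.two_le.trans this
  have hlogN : Real.log 2 ≤ Real.log (W.conductorNorm ℤ : ℝ) := Real.log_le_log (by norm_num) hN2
  have hlogN0 : 0 < Real.log (W.conductorNorm ℤ : ℝ) := lt_of_lt_of_le hlog2 hlogN
  -- `θ log N ≤ log p`
  have hθlog : θ * Real.log (W.conductorNorm ℤ : ℝ) ≤ Real.log p := by
    have := Real.log_le_log (Real.rpow_pos_of_pos (by linarith) θ) hNθ
    rwa [Real.log_rpow (by linarith)] at this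
  have hθlog0 : 0 < θ * Real.log (W.conductorNorm ℤ : ℝ) := mul_pos hθ hlogN0
  set v : ℝ := (((W.minimalDiscriminantNorm ℤ).factorization p : ℕ) : ℝ) with hv
  have hv0 : 0 ≤ v := by rw [hv]; exact_mod_cast Nat.zero_le _
  have h1 : v * Real.log p ≤ A * Real.log (W.conductorNorm ℤ) + A := hA W hss p hp
  -- hence `v · θ log N ≤ A log N + A`
  have h2 : v * (θ * Real.log (W.conductorNorm ℤ : ℝ)) ≤ A * Real.log (W.conductorNorm ℤ) + A :=
    (mul_le_mul_of_nonneg_left hθlog hv0).trans h1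
  have h3 : v ≤ (A * Real.log (W.conductorNorm ℤ) + A) / (θ * Real.log (W.conductorNorm ℤ : ℝ)) := by
    rw [le_div_iff₀ hθlog0]; exact h2
  have h4 : (A * Real.log (W.conductorNorm ℤ) + A) / (θ * Real.log (W.conductorNorm ℤ : ℝ)) =
      A / θ + A / (θ * Real.log (W.conductorNorm ℤ : ℝ)) := by
    field_simp
  have h5 : A / (θ * Real.log (W.conductorNorm ℤ : ℝ)) ≤ A / (θ * Real.log 2) := by
    apply div_le_div_of_nonneg_left hA0 (mul_pos hθ hlog2)
    exact mul_le_mul_of_nonneg_left hlogN hθ.le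
  calc v ≤ A / θ + A / (θ * Real.log (W.conductorNorm ℤ : ℝ)) := h3.trans_eq h4
    _ ≤ A / θ + A / (θ * Real.log 2) := by linarith

end Summit.ABC.ABC.Theorems.SharpDegreeOfPolyHeight

end
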